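import Summits.HodgeConjecture.HodgeConjecture.Theorems.TropicalWeilObstructionTropicalWeilVanishingCalibrationTwoSeedChecksB
import Summits.HodgeConjecture.HodgeConjecture.Theorems.TropicalWeilObstructionTropicalWeilVanishingCalibrationTwoSeedChecksC
import Summits.HodgeConjecture.HodgeConjecture.Theorems.TropicalWeilObstructionGenericWeilPeriodTwo
import Summits.HodgeConjecture.HodgeConjecture.Theorems.TropicalWeilObstructionTropicalWeilVanishingUnobstructedSeedAnyBase

/-!
# Route `TropicalWeilObstruction` (Kontsevich's tropical test — NEGATION SINK, exploration, no summit claim):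
# the `n = 2` CALIBRATION — on a very general tropical Weil FOURFOLD there is an effective tropical 2-cycle with `W ≠ 0`

Negation-sink bookkeeping of the cell `pub-hodge-tropical` (seat tropical-2 gen 7). The crux K1 (`TropicalWeilVanishing`,
stmt-HodgeConjecture-18478) bets that on the very general tropical Weil EIGHTFOLD (`n = 4`) every effective tropical `4`-cycle has Weil
functional `0`. Its `n = 2` analogue must FAIL, because on Weil-type abelian fourfolds with `K = ℚ(i)` the Weil classes are algebraic
(Schoen 1988; van Geemen 1996, via the automorphism-odd second-order theta functions whose image is a quadric; Markman 2025 in general).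
This file proves that failure in the tree's own format, from the integer certificate of `…CalibrationTwoSeedData{A–G}` /
`…CalibrationTwoSeedChecks{A,B,C}` (the tropicalised van Geemen exceptional cycle — excess locus of an isotropic triple of odd second-order
tropical theta divisors — at the rational period `Q₀ = QZ/2`, `240` cells, class `4θ₂ − 2 Re w`, `W = −μ ≠ 0`, UNOBSTRUCTED):

* `seed : TropicalTorusCycle (2 * 2) 2 QR` (`QR = QZ` as a real matrix — the doubled period, positive definite, `J`-commuting, rational)
  and `weilFunctional_seed_ne_zero`;
* `exists_weilGeneric_two_weilFunctional_ne_zero` — **there is a positive definite real `4 × 4` matrix `Q` commuting with `weilJ 2` whose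
  four free entries are algebraically independent over `ℚ`, and an effective tropical `2`-cycle `Z` on `ℝ⁴/Qℤ⁴` with `weilFunctional Z ≠ 0`**
  (the four integer sections of the linearised realisation system + `…UnobstructedSeedAnyBase` + `…GenericWeilPeriodTwo`);
* `not_tropicalWeilVanishing_two` — the verbatim `n = 2` analogue of the crux is false.

HONEST STATUS. A CALIBRATION of the method in the dimension where the answer is classically known; an independent kernel replication of
ring-2 seat b04 g37's seat computation (evidence n°21 on 18478). It decides NOTHING about K1 (`n = 4`, OPEN) or about the Hodge conjecture;
it shows that the certificate format, the Weil functional and `IsWeilGeneric` do carry `W ≠ 0` effective cycles at very general periods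
when geometry says they must. No named fact, no sorry.
References: [Zharkov2020TropicalWeil] I. Zharkov, arXiv:2002.02347, §2 (pp. 2–4); [MikhalkinZharkov2014Eigenwave] G. Mikhalkin,
I. Zharkov, LN UMI 15 (2014), Def. 4.2, Prop. 4.3; B. van Geemen, An introduction to the Hodge conjecture for abelian varieties,
LNM 1594 (1994), §7.5; C. Schoen, Compositio Math. 65 (1988).
-/

set_option linter.dupNamespace false

noncomputable section

namespace Summit.HodgeConjecture.HodgeConjecture.Theorems.TropicalWeilVanishing

namespace CalibTwo

open scoped BigOperators Matrix
open Matrix Literature.AlgebraicGeometry.Tropical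

/-! ### The period -/

/-- The doubled period as a real matrix: `QR a b = QZ a b`. [cite: Zharkov2020TropicalWeil, §2 (pp. 2–4)] -/
def QR : Matrix (Fin 4) (Fin 4) ℝ := fun a b => (QZ a b : ℝ)

/-- `J = weilJ 2` as an integer matrix. [cite: Zharkov2020TropicalWeil, §2 (pp. 2–4)] -/
def JZ : Matrix (Fin 4) (Fin 4) ℤ := !![0, 0, -1, 0; 0, 0, 0, -1; 1, 0, 0, 0; 0, 1, 0, 0]

/-- `J` as a real matrix with the entries of `JZ`. [cite: Zharkov2020TropicalWeil, §2 (pp. 2–4)] -/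
def JR : Matrix (Fin 4) (Fin 4) ℝ := fun a b => (JZ a b : ℝ)

/-- `weilJ 2 = JR`. [cite: Zharkov2020TropicalWeil, §2 (pp. 2–4)] -/
theorem weilJ_two_eq_JZ : (weilJ 2 : Matrix (Fin 4) (Fin 4) ℝ) = JR := by
  ext a b
  fin_cases a <;> fin_cases b <;> simp [weilJ, JZ, JR]

/-- `QZ` is symmetric and commutes with `JZ` (integer checks). [folklore] -/
theorem QZ_symm_comm : QZᵀ = QZ ∧ QZ * JZ = JZ * QZ := by decide

/-- `QR` is symmetric. [folklore] -/
theorem QR_isSymm : QR.IsSymm := by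
  ext a b
  have h := congrFun (congrFun QZ_symm_comm.1 a) b
  simp only [Matrix.transpose_apply] at h ⊢
  simp [QR, h]

/-- `QR` commutes with `J`. [folklore] -/
theorem QR_mul_weilJ : QR * (weilJ 2 : Matrix (Fin 4) (Fin 4) ℝ) = (weilJ 2 : Matrix (Fin 4) (Fin 4) ℝ) * QR := by
  rw [weilJ_two_eq_JZ]
  ext a b
  have h := congrFun (congrFun QZ_symm_comm.2 a) b
  simp only [Matrix.mul_apply] at h ⊢
  have h' := congrArg (Int.cast : ℤ → ℝ) h
  push_cast at h'
  simpa [QR, JR] using h'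

/-- The perturbation `E = QR/32 − 1`, entries in `{0, ±1/16, ±1/8}`. [folklore] -/
def Epert : Matrix (Fin 4) (Fin 4) ℝ :=
  !![0, 1/16, 0, 1/8; 1/16, 0, -1/8, 0; 0, -1/8, 0, 1/16; 1/8, 0, 1/16, 0]

/-- `QR` is positive definite: `QR = 32 • (1 + E)` with `E` symmetric, `|E_ab| ≤ 1/8`. [folklore] -/
theorem QR_posDef : QR.PosDef := by
  have hE : QR = (32 : ℝ) • (1 + Epert) := by
    ext a b
    fin_cases a <;> fin_cases b <;> norm_num [QR, QZ, Epert, Matrix.one_apply, Matrix.smul_apply, Matrix.add_apply]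
  have hsymm : Epertᵀ = Epert := by
    ext a b; fin_cases a <;> fin_cases b <;> norm_num [Epert]
  have hb : ∀ a b, |Epert a b| ≤ 1 / 8 := by
    intro a b; fin_cases a <;> fin_cases b <;> norm_num [Epert]
  rw [hE]
  exact (GenericWeilPeriodTwo.posDef_one_add hsymm hb).smul (by norm_num)

/-- `QR` has rational (indeed integer) entries. [folklore] -/
theorem QR_rat : ∃ q : Fin 4 → Fin 4 → ℚ, ∀ a b, QR a b = (q a b : ℝ) :=
  ⟨fun a b => (QZ a b : ℚ), fun a b => by simp [QR]⟩

/-! ### The cells and the cycle -/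

/-- The cells of the seed: weight `wt σ`, doubled vertices, frame `Fz σ`, doubled edge matrix. [folklore] -/
def cellC (σ : Fin N) : TropicalCell (2 * 2) 2 where
  weight := wt σ
  weight_pos := wt_pos σ
  vertex := fun k a => (Vz σ k a : ℝ)
  frame := Fz σ
  edgeCoeff := (Tz σ).map (Int.cast : ℤ → ℝ)
  vertex_succ_sub := by
    intro j a
    have h := congrArg (Int.cast : ℤ → ℝ) (vert_id σ j a)
    push_cast at h
    simpa [Matrix.map_apply] using h
  edgeCoeff_det_pos := by
    rw [Matrix.det_fin_two]
    simp only [Matrix.map_apply]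
    exact_mod_cast det_pos σ
  frame_saturated := ⟨Mz σ, leftinv σ⟩

/-- Plücker coordinates of a `4 × 2` integer matrix, written out. [folklore] -/
theorem pluckerCoord_eq_plk (L : Matrix (Fin 4) (Fin 2) ℤ) (S : Fin 2 → Fin 4) :
    pluckerCoord L S = plk L (S 0) (S 1) := by
  unfold pluckerCoord plk
  rw [Matrix.det_fin_two]
  simp [Matrix.submatrix_apply]

/-- The indicator double sum over facet slots of a class equals the sum over its slot list. [folklore] -/
theorem sum_ite_eq_slots (t : Fin N → Fin 3 → ℤ) (f : Fin K) :
    (∑ σ : Fin N, ∑ i : Fin 3, if cls σ i = f then t σ i else 0) = ((slots f).map fun x => t x.1 x.2).sum := by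
  classical
  rw [← Finset.sum_product' (f := fun σ i => if cls σ i = f then t σ i else 0), Finset.univ_product_univ,
    ← Finset.sum_filter]
  have hset : (Finset.univ.filter fun x : Fin N × Fin 3 => cls x.1 x.2 = f) = (slots f).toFinset := by
    ext x
    simp only [Finset.mem_filter, Finset.mem_univ, true_and, List.mem_toFinset]
    constructor
    · intro hx; rw [← hx]; exact slots_mem x.1 x.2
    · intro hx; exact slots_cls f x hx
  rw [hset, List.sum_toFinset _ (slots_nodup f)]

/-- **The seed**: the `240`-cell tropicalised van Geemen exceptional cycle as an effective tropical `2`-cycle on `ℝ⁴ / QR ℤ⁴` in the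
tree's certificate format. [cite: MikhalkinZharkov2014Eigenwave, Def. 4.2 and Prop. 4.3] -/
def seed : TropicalTorusCycle (2 * 2) 2 QR where
  numCells := N
  cell := cellC
  numFacetClasses := K
  refFacet := fun f j a => (Rz f j a : ℝ)
  facetClass := cls
  facetPerm := prm
  facetShift := Sz
  facet_eq := by
    intro σ i j a
    have h := congrArg (Int.cast : ℤ → ℝ) (facet_id σ i j a)
    push_cast at h
    simpa [cellC, QR] using h
  balanced := by
    intro f S
    have key : ∀ (σ : Fin N) (i : Fin 3),
        (if cls σ i = f then ((cellC σ).weight : ℤ) * (-1) ^ (i : ℕ) *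
            ((Equiv.Perm.sign (prm σ i) : ℤˣ) : ℤ) * pluckerCoord (cellC σ).frame S else 0)
          = (if cls σ i = f then (wt σ : ℤ) * (-1) ^ (i : ℕ) * sgn σ i * plk (Fz σ) (S 0) (S 1) else 0) := by
      intro σ i
      split_ifs
      · simp only [cellC, sign_prm, pluckerCoord_eq_plk]
      · rfl
    simp_rw [key, sum_ite_eq_slots (fun σ i => (wt σ : ℤ) * (-1) ^ (i : ℕ) * sgn σ i * plk (Fz σ) (S 0) (S 1)) f]
    exact balanced_red f (S 0) (S 1)

/-! ### The Weil functional of the seed -/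

/-- The complex frame determinant of a `4 × 2` integer frame in terms of `reEta`, `imEta`. [cite: Zharkov2020TropicalWeil, §2 (pp. 2–4)] -/
theorem frameComplexDet_two (L : Matrix (Fin 4) (Fin 2) ℤ) :
    frameComplexDet 2 L = ((reEta L : ℤ) : ℂ) + ((imEta L : ℤ) : ℂ) * Complex.I := by
  unfold frameComplexDet reEta imEta
  rw [Matrix.det_fin_two]
  have e0 : (⟨((0 : Fin 2) : ℕ), by omega⟩ : Fin (2 * 2)) = 0 := rfl
  have e1 : (⟨((1 : Fin 2) : ℕ), by omega⟩ : Fin (2 * 2)) = 1 := rfl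
  have e2 : (⟨((0 : Fin 2) : ℕ) + 2, by omega⟩ : Fin (2 * 2)) = 2 := rfl
  have e3 : (⟨((1 : Fin 2) : ℕ) + 2, by omega⟩ : Fin (2 * 2)) = 3 := rfl
  simp only [Matrix.of_apply, e0, e1, e2, e3, Complex.ext_iff, Complex.sub_re, Complex.sub_im, Complex.add_re, Complex.add_im,
    Complex.mul_re, Complex.mul_im, Complex.intCast_re, Complex.intCast_im, Complex.I_re, Complex.I_im, Int.cast_add, Int.cast_sub,
    Int.cast_mul, mul_zero, zero_mul, sub_zero, add_zero, mul_one, zero_add]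
  constructor <;> ring

/-- `2 · Re W(seed) = reW2` (the `2` is the `2!` of the lattice volume). [folklore] -/
theorem two_mul_weilFunctional_seed_re : 2 * (weilFunctional seed).re = (reW2 : ℝ) := by
  have h := congrArg (Int.cast : ℤ → ℝ) reW2_sum
  rw [← h]
  unfold weilFunctional
  rw [Complex.re_sum, Finset.mul_sum]
  push_cast
  refine Finset.sum_congr rfl fun σ _ => ?_
  simp only [seed, cellC, TropicalCell.latticeVolume, frameComplexDet_two]
  rw [Matrix.det_fin_two]
  simp only [Matrix.map_apply, Nat.factorial, Nat.succ_eq_add_one, Nat.reduceAdd, Nat.reduceMul, Nat.cast_ofNat,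
    Complex.mul_re, Complex.add_re, Complex.add_im, Complex.mul_im, Complex.ofReal_re, Complex.ofReal_im,
    Complex.natCast_re, Complex.natCast_im, Complex.intCast_re, Complex.intCast_im, Complex.I_re, Complex.I_im, sq]
  ring

/-- **`W(seed) ≠ 0`.** [folklore] -/
theorem weilFunctional_seed_ne_zero : weilFunctional seed ≠ 0 := by
  intro h
  have h2 := two_mul_weilFunctional_seed_re
  rw [h, Complex.zero_re, mul_zero] at h2
  exact reW2_ne_zero (by exact_mod_cast h2.symm)

/-! ### The four directions span `Sym_J` (`n = 2`) -/

/-- The directions as real matrices. [folklore] -/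
def ER (t : Fin 4) : Matrix (Fin 4) (Fin 4) ℝ := fun a b => (E2 t a b : ℝ)

/-- Every symmetric `J`-commuting real `4 × 4` matrix is a real combination of `ER 0, …, ER 3` (it is `[[a,c,0,b],[c,d,−b,0],[0,−b,a,c],
[b,0,c,d]]`). [cite: Zharkov2020TropicalWeil, §2 (pp. 2–4)] -/
theorem mem_span_ER (D : Matrix (Fin 4) (Fin 4) ℝ) (hS : D.IsSymm)
    (hJ : D * (weilJ 2 : Matrix (Fin 4) (Fin 4) ℝ) = (weilJ 2 : Matrix (Fin 4) (Fin 4) ℝ) * D) :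
    D ∈ Submodule.span ℝ (Set.range ER) := by
  rw [Submodule.mem_span_range_iff_exists_fun]
  -- entry relations from symmetry and `DJ = JD`
  have hs : ∀ a b, D b a = D a b := fun a b => by
    have := congrFun (congrFun hS a) b; simpa [Matrix.transpose_apply] using this
  rw [weilJ_two_eq_JZ] at hJ
  have hj : ∀ a b, (D * JR) a b = (JR * D) a b := fun a b => by rw [hJ]
  have h00 := hj 0 0; have h01 := hj 0 1; have h02 := hj 0 2; have h03 := hj 0 3
  have h11 := hj 1 1; have h12 := hj 1 2; have h13 := hj 1 3
  simp [Matrix.mul_apply, Fin.sum_univ_four, JR, JZ] at h00 h01 h02 h03 h11 h12 h13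
  refine ⟨![D 0 0 / 2, D 0 1 / 2, D 1 1 / 2, D 0 3 / 2], ?_⟩
  ext a b
  simp only [Matrix.sum_apply, Matrix.smul_apply, Fin.sum_univ_four, ER, E2, smul_eq_mul]
  have s10 := hs 0 1; have s20 := hs 0 2; have s30 := hs 0 3; have s21 := hs 1 2; have s31 := hs 1 3; have s32 := hs 2 3
  fin_cases a <;> fin_cases b <;> simp <;> linarith

/-! ### The calibration theorem -/

/-- **The `n = 2` calibration.** There are a positive definite real `4 × 4` matrix `Q` commuting with `J = weilJ 2` whose four free
entries are algebraically independent over `ℚ` (a very general tropical Weil fourfold period) and an effective tropical `2`-cycle `Z` on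
`ℝ⁴/Qℤ⁴` (`240` cells) with `weilFunctional Z ≠ 0`. [cite: Zharkov2020TropicalWeil, §2 (pp. 2–4)] -/
theorem exists_weilGeneric_two_weilFunctional_ne_zero :
    ∃ Q : Matrix (Fin (2 * 2)) (Fin (2 * 2)) ℝ, Q.PosDef ∧ Q * weilJ 2 = weilJ 2 * Q ∧ IsWeilGeneric 2 Q ∧
      ∃ Z : TropicalTorusCycle (2 * 2) 2 Q, Z.numCells = 240 ∧ weilFunctional Z ≠ 0 := by
  have hacc := GenericWeilPeriodTwo.exists_weilGeneric_two_mem_of_open QR QR_rat QR_posDef QR_mul_weilJ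
  have h := exists_weilGeneric_weilFunctional_ne_zero_of_sections_on_spanning_family QR_isSymm QR_mul_weilJ
    (fun U hU h0 => hacc U hU h0) seed weilFunctional_seed_ne_zero ER mem_span_ER
    (fun t σ k a => (SV t σ k a : ℝ)) (fun t σ => (ST t σ).map (Int.cast : ℤ → ℝ)) (fun t f j a => (SR t f j a : ℝ))
    (fun t σ j a => by
      have e := congrArg (Int.cast : ℤ → ℝ) (sec_vert t σ j a)
      push_cast at e
      simpa [seed, cellC, Matrix.map_apply] using e)
    (fun t σ i j a => by
      have e := congrArg (Int.cast : ℤ → ℝ) (sec_facet t σ i j a)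
      push_cast at e
      simpa [seed, cellC, ER] using e)
  exact h

/-- **The verbatim `n = 2` analogue of the crux `TropicalWeilVanishing` is false.** [cite: Zharkov2020TropicalWeil, §2 (pp. 2–4)] -/
theorem not_tropicalWeilVanishing_two :
    ¬ (∀ Q : Matrix (Fin (2 * 2)) (Fin (2 * 2)) ℝ, Q.PosDef → Q * weilJ 2 = weilJ 2 * Q → IsWeilGeneric 2 Q →
        ∀ Z : TropicalTorusCycle (2 * 2) 2 Q, weilFunctional Z = 0) := by
  intro h
  obtain ⟨Q, hQ, hQJ, hgen, Z, -, hW⟩ := exists_weilGeneric_two_weilFunctional_ne_zero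
  exact hW (h Q hQ hQJ hgen Z)

end CalibTwo

end Summit.HodgeConjecture.HodgeConjecture.Theorems.TropicalWeilVanishing

end
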